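import Summits.QuantumFields.YangMills.Theorems.UnitScaleTiltHalvingP1FlatCoreCubeInclusion
import Literature.MathematicalPhysics.QuantumFieldTheory.Balaban1983to89.B8Eq191FlatStencils
import Literature.MathematicalPhysics.QuantumFieldTheory.Balaban1983to89.B8CubeMemberZd
import Summits.QuantumFields.YangMills.Theorems.UnitScaleTiltProp7AxialResidualFreedom
import HarnessLib

/-!
# Route `UnitScaleTilt`, crux K1 child «MinimiserStabilityRegPr» (stmt-QuantumFields-19200), registered stub V2′ `stub_halvingStep` (v10 `BirthV10`) —
# **J5b TRANSPORT, PART 2a (ℤ³ side, letter-stable): N05's FLAT MULTIPLIER FIELD `Q′(1)ᵀμ` IS CONSTANT ON EVERY ROUTE CELL OF POSITIVE LEVEL** —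
# the three geometric facts behind the transport of the pillar's Landau row (iv) along J1b's levelwise inclusion `□_j^{route} ⊆ □_j^{N05}` (LEAD-H L-5 (D1))

Cell `ym3-torus` (HUMAN RULING D-0037, YM ladder rung R3 — continuum SU(2) YM₃ on the three-torus is a RUNG, NOT the Clay problem), width seat `ym-ust-19936-w7`
gen 4, cross-item hand on line H (★★OWNER ACK 45 (a) J5; LEAD-H L-5 J5b; tag worded by the OWNER: `--supports stmt-QuantumFields-19200 --as helper`).
Definition-free, 0 sorry, standard axioms.

WHY.  Part 1 (✓`HalvingP1FlatCoreTransport`) showed: (iv) of ✓`P1FlatPillarAt'` ⟺ `Δ∂*A` is constant on every index cell of the route's tower.  N05's Landau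
output at its own member (✓`HalvingP1FlatCoreTopStepSocket.p5Step_ofConstraint_of_HFP`: `IsLandau138W …`, i.e. `Δ↾Ω₀ ∂*A♯ = Q′(1)ᵀμ` on `Ω₀ = □₀^{N05}`) has
the flat right-hand side ✓`B8Eq191FlatStencils.QT_flat_apply`: `(Q′(1)ᵀμ)(z) = Σ_{j′≤k} L^{−3j′}•(Λs j′).indicator (μ j′) (⌊z∕L^{j′}⌋)`.  On a route cell of level
`j ≥ 1` the representatives `z, z′` share `⌊·∕Lʲ⌋` (J1b ✓`iterBlockOf_cover_eq_iff_flm_eq`) and lie in `□_j^{N05}` (J1b ✓`mem_cube_of_cover_mem_cubeSetM`); THIS FILE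
proves that this makes the right-hand side equal at `z` and `z′`:
* §1 ★`flm_eq_of_flm_eq_of_le` — equal `Lʲ`-blocks ⇒ equal `L^{j′}`-blocks for every `j′ ≥ j` (nested floors).
* §2 ★`flm_not_mem_LamP_of_mem_cube` — a site of `□_j^{N05}` (`1 ≤ j ≤ k`) has NO block ancestor of level `j′ < j` in print's layer `Λ′_{j′}` (✓`B8Eq131Cubes.LamP`): its
  `L^{j′}`-block is inside `□_{j′+1}` (✓`cube_anti`, ✓`cube_blockSat`, ✓`smul_mem_cube_succ_iff`, ✓`under_smul_iff`); the same for the member's `cubeLam` (✓`B8CubeMemberZd`,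
  `= Λ′_{j′}` for `j′ ≥ 1`, `□₀ ∖ □₁` at `j′ = 0`).
* §3 ★★`QT_one_eq_of_flm_eq` (abstract layers with the vanishing property) and ★★`QT_one_LamP_eq_of_mem_cube` ∕ `QT_one_cubeLam_eq_of_mem_cube` — `Q′(1)ᵀμ` takes ONE value
  on `{z′ ∈ □_j^{N05} ∕∕ ⌊z′∕Lʲ⌋ = ⌊z∕Lʲ⌋}`, `j ≤ k`.
Part 2b (the junction `covLap (covDivB A♯) (rep s) = Δ∂*A (s)` on the footprint inside `□₀^{route}` and the assembly into the route's (iv) through ✓`multiplierForm_of_cellConst`)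
follows once the J4 pair's output letters (`Ω 0`, `Λs`, `A♯`) are posted (LEAD-H to confirm).
HONEST SCOPE.  Integer-lattice bookkeeping over landed identities; NOTHING of J4 or of the stub is proved here.  NOT a claim about [Balaban1985RegularSpaces] Thm 2, the stub,
the crux, the rung or the mass gap; no summit statement is proved by this seat.

References: T. Bałaban, CMP **99** (1985) 75–102 [Balaban1985RegularSpaces] (1.5)–(1.6) p.77, (1.29) p.81, (1.131) p.99; CMP **99** (1985) 389–434 [Balaban1985BackgroundPropagators]
(3.19)–(3.24) pp.393–394; CMP **96** (1984) 223–250 [Balaban1984PropagatorsII] (2.3) p.224.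
-/

set_option autoImplicit false

noncomputable section

open scoped BigOperators

namespace Summit.QuantumFields.YangMills.Theorems.HalvingP1FlatCoreTransportZd

open Literature.MathematicalPhysics.QuantumFieldTheory.Balaban1983to89
open B7Prop1Explicit renaming Site → LSite
open B7Prop1Local (InBox)
open B8Ineq132 (Under)
open B8Eq131Cubes (cube LamP flm under_flm cube_anti)
open B8Eq131CubesAdmissible (smul_mem_cube_succ_iff)
open B8CubeMemberZd (cubeLam cubeLam_eq_LamP mem_cubeLam_zero_iff cube_blockSat under_smul_iff)
open B8Eq138LandauZd (QT)
open B8Eq191FlatStencils (QT_flat_apply)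
open Literature.MathematicalPhysics.QuantumLattice (blockMap)
open B7BlockGeometry (blockMap_blockMap)
open P1FlatCoreCubeInclusion (blockMap_pow_eq_flm)

variable {d : ℕ}

/-! ## §1 Nested floors -/

/-- `⌊z∕L^{j+i}⌋ = ⌊⌊z∕Lʲ⌋∕Lⁱ⌋` (blocks of blocks). [cite: Balaban1985RegularSpaces, (1.6) p.77] -/
theorem flm_add (L j i : ℕ) (z : LSite d) : flm L (j + i) z = flm L i (flm L j z) := by
  rw [← blockMap_pow_eq_flm, ← blockMap_pow_eq_flm, ← blockMap_pow_eq_flm, pow_add, blockMap_blockMap]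

/-- ★ **EQUAL `Lʲ`-BLOCKS ⇒ EQUAL `L^{j′}`-BLOCKS FOR `j′ ≥ j`.** [cite: Balaban1985RegularSpaces, (1.6) p.77] -/
theorem flm_eq_of_flm_eq_of_le (L : ℕ) {j j' : ℕ} (hjj : j ≤ j') {z z' : LSite d} (h : flm L j z = flm L j z') :
    flm L j' z = flm L j' z' := by
  obtain ⟨i, rfl⟩ := Nat.exists_eq_add_of_le hjj
  rw [flm_add, flm_add, h]

/-! ## §2 A site of `□_j` has no lower-level block ancestor in a layer `Λ′_{j′}`, `j′ < j` -/

/-- The `L^{j′}`-block corner of a site of `□_{j′+1}` lies in `□_{j′+1}` (the cubes are unions of `L^{j′+1}`-blocks). [cite: Balaban1985RegularSpaces, (1.6) p.77, p.98] -/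
theorem smul_flm_mem_cube_succ {L : ℕ} (hL : 1 ≤ L) (a : LSite d) (M ρ k j' : ℕ) {z : LSite d} (hz : z ∈ cube L a M ρ k (j' + 1)) :
    ((L : ℤ) ^ j') • flm L j' z ∈ cube L a M ρ k (j' + 1) := by
  refine cube_blockSat hL a M ρ k (j' + 1) hz ?_
  -- `Lʲ′•⌊z∕Lʲ′⌋ ∈ B^{j′+1}(⌊z∕L^{j′+1}⌋)`: the `j′`-block corner lies in the `(j′+1)`-block of `z`
  have h1 : Under L 1 (flm L (j' + 1) z) (flm L j' z) := by
    rw [flm_add]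
    exact under_flm hL 1 _
  have h := (under_smul_iff hL 1 j' (flm L (j' + 1) z) (flm L j' z)).2 h1
  rwa [Nat.add_comm] at h

/-- ★ **NO LOWER ANCESTOR IN PRINT'S LAYERS**: for `z ∈ □_j^{N05}` with `1 ≤ j ≤ k` and `j′ < j`, the `L^{j′}`-block label of `z` is NOT in `Λ′_{j′} = LamP … j′`
(it is inside `□_{j′+1}^{(j′)}`; at `j′ = 0`: `z ∈ □₁`). [cite: Balaban1985RegularSpaces, (1.131) p.99] -/
theorem flm_not_mem_LamP_of_mem_cube {L : ℕ} (hL : 1 ≤ L) {a : LSite d} {M ρ k j j' : ℕ} (hj' : j' < j) (hjk : j ≤ k) {z : LSite d}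
    (hz : z ∈ cube L a M ρ k j) : flm L j' z ∉ LamP L a M ρ k j' := by
  have hz1 : z ∈ cube L a M ρ k (j' + 1) := cube_anti (Nat.succ_le_of_lt hj') hjk hz
  by_cases hj0 : j' = 0
  · subst hj0
    have h0 : flm L 0 z = z := Prop7AxialResidualFreedom.flm_zero L z
    simp only [LamP, if_true, Set.mem_setOf_eq, not_not, h0]
    simpa using hz1
  · have hin : InBox (B8Eq131Cubes.inLo L a ρ k j') (B8Eq131Cubes.inHi L a M ρ k j') (flm L j' z) :=
      (smul_mem_cube_succ_iff hL a M ρ (lt_of_lt_of_le hj' hjk) (flm L j' z)).1 (smul_flm_mem_cube_succ hL a M ρ k j' hz1)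
    simp only [LamP, if_neg hj0, Set.mem_setOf_eq, not_and, not_forall, not_not]
    intro _
    exact ⟨lt_of_lt_of_le hj' hjk, hin⟩

/-- The same for the member's restriction layers `cubeLam` of ✓`B8CubeMemberZd` (`= Λ′_{j′}` for `j′ ≥ 1`, `□₀ ∖ □₁` at `j′ = 0`; `1 ≤ k`).
[cite: Balaban1985RegularSpaces, (1.5) p.77, (1.131) p.99] -/
theorem flm_not_mem_cubeLam_of_mem_cube {L : ℕ} (hL : 1 ≤ L) {a : LSite d} {M ρ k j j' : ℕ} (hj' : j' < j) (hjk : j ≤ k) {z : LSite d}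
    (hz : z ∈ cube L a M ρ k j) : flm L j' z ∉ cubeLam L a M ρ k j' := by
  by_cases hj0 : j' = 0
  · subst hj0
    have hz1 : z ∈ cube L a M ρ k 1 := cube_anti (Nat.succ_le_of_lt hj') hjk hz
    rw [Prop7AxialResidualFreedom.flm_zero L z, mem_cubeLam_zero_iff hL a M ρ (by omega)]
    exact fun h => h.2 hz1
  · rw [cubeLam_eq_LamP L a M ρ k (Nat.one_le_iff_ne_zero.2 hj0)]
    exact flm_not_mem_LamP_of_mem_cube hL hj' hjk hz

/-! ## §3 The flat multiplier field `Q′(1)ᵀμ` is constant on the route cells of positive level -/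

section QT

variable {𝔸 : Type*} [NormedRing 𝔸] [NormedAlgebra ℂ 𝔸] [CompleteSpace 𝔸]

/-- ★★ **`Q′(1)ᵀμ` IS CONSTANT WHERE THE `Lʲ`-BLOCKS AGREE AND NO LOWER LAYER IS MET** (abstract layers): if `⌊z∕Lʲ⌋ = ⌊z′∕Lʲ⌋` and for every `j′ < j` neither
`⌊z∕L^{j′}⌋` nor `⌊z′∕L^{j′}⌋` lies in `Λs j′`, then `(Q′(1)ᵀμ)(z) = (Q′(1)ᵀμ)(z′)` (✓`QT_flat_apply`: the levels `j′ < j` contribute `0`, the levels `j′ ≥ j` read equal blocks).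
[cite: Balaban1985BackgroundPropagators, (3.19)-(3.24) pp.393-394; Balaban1985RegularSpaces, (1.29) p.81] -/
theorem QT_one_eq_of_flm_eq (L m : ℕ) (Λs : ℕ → Set (LSite d)) (μ : ℕ → LSite d → 𝔸) {j : ℕ} {z z' : LSite d}
    (hflm : flm L j z = flm L j z') (hvan : ∀ j', j' < j → flm L j' z ∉ Λs j' ∧ flm L j' z' ∉ Λs j') :
    QT L m Λs (1 : LSite d → Fin d → 𝔸ˣ) μ z = QT L m Λs (1 : LSite d → Fin d → 𝔸ˣ) μ z' := by
  rw [QT_flat_apply, QT_flat_apply]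
  refine Finset.sum_congr rfl fun j' _ => ?_
  rw [blockMap_pow_eq_flm, blockMap_pow_eq_flm]
  rcases lt_or_ge j' j with hlt | hge
  · rw [Set.indicator_of_notMem (hvan j' hlt).1, Set.indicator_of_notMem (hvan j' hlt).2]
  · rw [flm_eq_of_flm_eq_of_le L hge hflm]

/-- ★★ **`Q′(1)ᵀμ` OF THE N05 TOWER (print's layers `Λ′ = LamP`) IS CONSTANT ON `{z′ ∈ □_j ∕∕ ⌊z′∕Lʲ⌋ = ⌊z∕Lʲ⌋}`, `j ≤ k`** — the right-hand side of N05's flat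
Landau condition takes one value on every route cell of positive level (with J1b's ✓`iterBlockOf_cover_eq_iff_flm_eq` + ✓`mem_cube_of_cover_mem_cubeSetM`).
[cite: Balaban1985RegularSpaces, (1.29) p.81, (1.131) p.99] -/
theorem QT_one_LamP_eq_of_mem_cube {L : ℕ} (hL : 1 ≤ L) (a : LSite d) (M ρ k m : ℕ) (μ : ℕ → LSite d → 𝔸) {j : ℕ} (hjk : j ≤ k)
    {z z' : LSite d} (hz : z ∈ cube L a M ρ k j) (hz' : z' ∈ cube L a M ρ k j) (hflm : flm L j z = flm L j z') :
    QT L m (LamP L a M ρ k) (1 : LSite d → Fin d → 𝔸ˣ) μ z = QT L m (LamP L a M ρ k) (1 : LSite d → Fin d → 𝔸ˣ) μ z' :=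
  QT_one_eq_of_flm_eq L m _ μ hflm fun _ hj' =>
    ⟨flm_not_mem_LamP_of_mem_cube hL hj' hjk hz, flm_not_mem_LamP_of_mem_cube hL hj' hjk hz'⟩

/-- The same for the member's restriction layers `cubeLam`. [cite: Balaban1985RegularSpaces, (1.5) p.77, (1.29) p.81] -/
theorem QT_one_cubeLam_eq_of_mem_cube {L : ℕ} (hL : 1 ≤ L) (a : LSite d) (M ρ k m : ℕ) (μ : ℕ → LSite d → 𝔸) {j : ℕ} (hjk : j ≤ k)
    {z z' : LSite d} (hz : z ∈ cube L a M ρ k j) (hz' : z' ∈ cube L a M ρ k j) (hflm : flm L j z = flm L j z') :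
    QT L m (cubeLam L a M ρ k) (1 : LSite d → Fin d → 𝔸ˣ) μ z = QT L m (cubeLam L a M ρ k) (1 : LSite d → Fin d → 𝔸ˣ) μ z' :=
  QT_one_eq_of_flm_eq L m _ μ hflm fun _ hj' =>
    ⟨flm_not_mem_cubeLam_of_mem_cube hL hj' hjk hz, flm_not_mem_cubeLam_of_mem_cube hL hj' hjk hz'⟩

end QT

end Summit.QuantumFields.YangMills.Theorems.HalvingP1FlatCoreTransportZd

end
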